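import Literature.NumberTheory.GaloisRepresentations.InducedGaloisRep
import Literature.NumberTheory.GaloisRepresentations.CliffordTwistOfRestriction
import Mathlib.RepresentationTheory.Irreducible
import HarnessLib

/-!
# Mackey's irreducibility criterion for `Ind_{Γ_F}^{Γ_K} ψ` (matrix form), also after
# restriction to a subgroup, and its absolutely irreducible form

Topic `Literature/NumberTheory/GaloisRepresentations`.  Theorem-only file (no named fact, no new
notion): the "sufficient" half of Mackey's criterion (Serre, *Linear representations of finite
groups*, §7.4, Cor. of Prop. 23: for `H ◁ G`, `Ind_H^G ρ` is irreducible iff `ρ` is irreducible and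
not isomorphic to any conjugate `ρ^s`, `s ∉ H`; Curtis–Reiner (10.25)) for the tree's matrix model
`FramedGaloisRep.induce K hd ψ : Γ_K →ₜ* GL_{d m}(A)` of `Ind_{Γ_F}^{Γ_K} ψ` along a finite Galois
extension `F/K` of degree `d` (`InducedGaloisRep`: blocks `ψ̇(rᵢ⁻¹ g rⱼ)` for the chosen coset
representatives `rᵢ = absGaloisCosetRep K F hd i`), over an ARBITRARY field of coefficients `A`
(so that it applies to residual representations), in three layers:

* `FramedGaloisRep.induce_stable_eq_top_of_subgroup` — **the criterion relative to a subgroup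
  `Λ ≤ Γ_K`**: if the conjugates `ψ^{rᵢ⁻¹}` (`FramedGaloisRep.outerConj`) have no non-trivial
  stable subspace under `Λ_F = res⁻¹(Λ) ≤ Γ_F`, are pairwise non-conjugate on `Λ_F`, and `Λ` moves
  block `i` to block `k` for all `i, k` (an element `r_k · res(σ) · rᵢ⁻¹ ∈ Λ`), then every non-zero
  `Λ`-stable subspace of `A^{dm}` is everything.  Proof (elementary, any field, no semisimplicity,
  no Frobenius reciprocity): on `res(Γ_F)` the matrix `Ind(ψ)(res σ)` is block diagonal with blocks
  `ψ^{rᵢ⁻¹}(σ)` (`induce_absGaloisRestrict_coe`), so the block projections are `Λ_F`-equivariant; a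
  MINIMAL non-zero `Λ_F`-stable subspace `U` of a `Λ`-stable `W ≠ 0` maps under each projection to
  `0` or isomorphically onto `A^m`; two such isomorphisms would conjugate `ψ^{rᵢ⁻¹}|_{Λ_F}` into
  `ψ^{rⱼ⁻¹}|_{Λ_F}`, so `U` is a full block `Vᵢ ⊆ W`; and `Ind(ψ)(r_k res(σ) rᵢ⁻¹) Vᵢ = V_k`
  (`induce_mulVec_blockVec_of_eq`), so `W ⊇ ⊕_k V_k`.
* `FramedGaloisRep.isIrreducible_induce_of_forall_ne_conj` (`Λ = Γ_K`: **Mackey's criterion**,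
  `Ind(ψ)` irreducible for `ψ` irreducible with pairwise non-conjugate `ψ^{rᵢ⁻¹}`) and
  `FramedGaloisRep.isIrreducible_restrictField_induce` (`Λ = res(Γ_L)` normal with
  `res(Γ_L) · res(Γ_F) = Γ_K`, i.e. `L ∩ F = K`: **`(Ind_{Γ_F}^{Γ_K} ψ)|_{Γ_L}` is irreducible** as
  soon as `ψ` is irreducible and non-conjugate to its `ψ^g`, `g ∉ res(Γ_F)`, already on
  `Λ_F = Γ_{F L}` — Mackey's `Res_{Γ_L} Ind_{Γ_F}^{Γ_K} ψ ≅ Ind_{Γ_{FL}}^{Γ_L} Res ψ`, Serre §7.3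
  Prop. 22, followed by the criterion over `L`, proved here in one stroke without constructing the
  compositum).
* `FramedGaloisRep.isAbsolutelyIrreducible_induce_of_charpoly_ne`,
  `FramedGaloisRep.isAbsolutelyIrreducible_restrictField_induce`,
  `FramedGaloisRep.isAbsolutelyIrreducible_restrictField_induce_of_finrank_eq_two` — the
  **absolutely irreducible forms** (`FramedRep.IsAbsolutelyIrreducible`, base change to every
  field `B ⊇ A`: `Ind` and restriction commute with base change, `induce_baseChange`), with the
  non-conjugacy witnessed by DIFFERENT CHARACTERISTIC POLYNOMIALS at one element (a condition
  stable under field extension), and the subgroup `Λ_F` presented as `Γ_M` for an extension `M/F`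
  with `res(Γ_M) = res⁻¹(res Γ_L)` (hypothesis `hM`; for `L = K(ζ)`, `M = F(ζ)`).  The quadratic
  case `[F : K] = 2` needs only `res(Γ_L) ⊄ res(Γ_F)` (`L ⊄ F`): this is the shape of hypothesis
  (4) "`(Ind_E^K r)|_{K(ζ_p)}` absolutely irreducible" of the potential-automorphy theorems
  (Barnet-Lamb–Gee–Geraghty–Taylor, Thm. C) for a twisted quadratic induction.

The case `Λ = Γ_K` is also proved on the Summits side
(`Summit.Langlands.Langlands.Theorems.IrreducibleOffSector.isIrreducible_induce_of_not_conj`,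
file `IrreducibilityBySelfDualityIrreducibleOffSectorMackeyInduced`), whose block calculus is
adapted here (`-- adapted from` comments); Literature cannot import Summits files.

## Not here

The "necessary" half of Mackey's criterion (`Ind` of a restriction is reducible:
`InduceRestrictFieldReducible`; an irreducible `r` with reducible restriction is induced:
`CliffordInducedPrimeIndex`), non-normal subgroups (general `H_s = sHs⁻¹ ∩ H`), and the residual
(`IsResiduallyAbsIrreducible`) bookkeeping of reductions of `Ind`.

## References

* J.-P. Serre, *Linear representations of finite groups*, GTM 42 (1977), §7.3 Prop. 22, §7.4
  Prop. 23 and Cor. [SerreLinearRepresentations1977]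
* C. W. Curtis, I. Reiner, *Representation theory of finite groups and associative algebras*
  (1962), (10.25), §45 (Mackey's theorems). [CurtisReiner1962]
-/

noncomputable section

open Matrix Field

namespace Literature.NumberTheory.GaloisRepresentations

universe u v w

/-! ### Block calculus for `Ind(ψ)` -/

section Blocks

variable (K : Type u) {F : Type v} [Field K] [Field F] [Algebra K F] [CharZero K]
  [FiniteDimensional K F] {A : Type w} [CommRing A] [TopologicalSpace A] {d m : ℕ}

namespace FramedGaloisRep

/-- **`Ind(ψ)(r_k · res(σ) · rᵢ⁻¹)` moves block `i` to block `k`, acting there by `ψ(σ)`**: on the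
`i`-th block copy of `v ∈ A^m` it gives the `k`-th block copy of `ψ(σ) v` (block `(j, i)` of
`Ind(ψ)(r_k res(σ) rᵢ⁻¹)` is `ψ̇(rⱼ⁻¹ r_k res(σ))`, i.e. `ψ(σ)` for `j = k` and `0` otherwise).
[cite: SerreLinearRepresentations1977, §3.3 Thm. 12 (proof)] -/
theorem induce_mulVec_blockVec_of_eq (hd : Module.finrank K F = d) (ψ : FramedGaloisRep F A m)
    (i k : Fin d) (σ : absoluteGaloisGroup F) (v : Fin m → A) :
    ((ψ.induce K hd (absGaloisCosetRep K F hd k * absGaloisRestrict K F σ *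
          (absGaloisCosetRep K F hd i)⁻¹) : GL (Fin (d * m)) A) :
        Matrix (Fin (d * m)) (Fin (d * m)) A) *ᵥ
        (fun x => if (finProdFinEquiv.symm x).1 = i then v (finProdFinEquiv.symm x).2 else 0) =
      fun x => if (finProdFinEquiv.symm x).1 = k then
        (((ψ σ : GL (Fin m) A) : Matrix (Fin m) (Fin m) A) *ᵥ v) (finProdFinEquiv.symm x).2
        else 0 := by
  -- adapted from Summit.Langlands.Langlands.Theorems.IrreducibleOffSector.induce_mulVec_blockVec
  classical
  funext x
  obtain ⟨⟨j, a⟩, rfl⟩ := finProdFinEquiv.surjective x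
  rw [Matrix.mulVec, dotProduct, ← finProdFinEquiv.sum_comp, Fintype.sum_prod_type,
    Finset.sum_eq_single i]
  · simp only [Equiv.symm_apply_apply, if_true]
    have hentry : ∀ b : Fin m,
        ((ψ.induce K hd (absGaloisCosetRep K F hd k * absGaloisRestrict K F σ *
              (absGaloisCosetRep K F hd i)⁻¹) : GL (Fin (d * m)) A) :
            Matrix (Fin (d * m)) (Fin (d * m)) A) (finProdFinEquiv (j, a))
            (finProdFinEquiv (i, b)) =
          dotExtend (absGaloisRestrict K F).toMonoidHom (FramedRep.toMatrixHom ψ)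
            ((absGaloisCosetRep K F hd j)⁻¹ * absGaloisCosetRep K F hd k *
              absGaloisRestrict K F σ) a b := by
      intro b
      rw [induce_apply_coe_apply, Equiv.symm_apply_apply, Equiv.symm_apply_apply]
      have hg : (absGaloisCosetRep K F hd j)⁻¹ *
            (absGaloisCosetRep K F hd k * absGaloisRestrict K F σ *
              (absGaloisCosetRep K F hd i)⁻¹) * absGaloisCosetRep K F hd i =
          (absGaloisCosetRep K F hd j)⁻¹ * absGaloisCosetRep K F hd k *
            absGaloisRestrict K F σ := by
        group
      rw [hg]
    simp_rw [hentry]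
    by_cases hjk : j = k
    · subst hjk
      rw [if_pos rfl, inv_mul_cancel, one_mul, dotExtend_absGaloisRestrict]
      rfl
    · rw [if_neg hjk, dotExtend_of_not_mem]
      · simp
      · intro hmem
        apply hjk
        have h2 : (absGaloisRestrict K F σ)⁻¹ ∈ (absGaloisRestrict K F).toMonoidHom.range :=
          (absGaloisRestrict K F).toMonoidHom.range.inv_mem ⟨σ, rfl⟩
        have h3 := (absGaloisRestrict K F).toMonoidHom.range.mul_mem hmem h2
        rw [mul_inv_cancel_right] at h3
        exact (absGaloisCosetRep_bijective K F hd).1 (QuotientGroup.eq.2 h3)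
  · intro j' _ hj'
    refine Finset.sum_eq_zero fun b _ => ?_
    simp only [Equiv.symm_apply_apply, if_neg hj', mul_zero]
  · intro hi
    exact absurd (Finset.mem_univ i) hi

variable [IsGalois K F] [CharZero F]

/-- **Block-diagonal action of `res(Γ_F)` on `Ind(ψ)`, coordinatewise**: for `σ ∈ Γ_F`, the
`(i, a)`-coordinate of `Ind(ψ)(res σ) · w` is the `a`-coordinate of `ψ^{rᵢ⁻¹}(σ) · wᵢ`, `wᵢ` the
`i`-th block of `w` (`Res Ind ψ = ⊕ᵢ ψ^{rᵢ⁻¹}`); stated as an identity of vectors in `A^m`.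
[cite: SerreLinearRepresentations1977, §7.3 Prop. 22] -/
theorem induce_absGaloisRestrict_mulVec_block (hd : Module.finrank K F = d)
    (ψ : FramedGaloisRep F A m) (σ : absoluteGaloisGroup F) (w : Fin (d * m) → A) (i : Fin d) :
    (fun a : Fin m => (((ψ.induce K hd (absGaloisRestrict K F σ) : GL (Fin (d * m)) A) :
        Matrix (Fin (d * m)) (Fin (d * m)) A) *ᵥ w) (finProdFinEquiv (i, a))) =
      ((ψ.outerConj (absGaloisCosetRep K F hd i)⁻¹ σ : GL (Fin m) A) : Matrix (Fin m) (Fin m) A) *ᵥ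
        fun b => w (finProdFinEquiv (i, b)) := by
  -- adapted from Summit.Langlands.Langlands.Theorems.IrreducibleOffSector.induce_absGaloisRestrict_mulVec_block
  classical
  funext a
  rw [induce_absGaloisRestrict_coe K hd ψ σ, Matrix.mulVec, Matrix.mulVec, dotProduct, dotProduct,
    ← finProdFinEquiv.sum_comp, Fintype.sum_prod_type, Finset.sum_eq_single i]
  · refine Finset.sum_congr rfl fun b _ => ?_
    rw [Matrix.reindex_apply, Matrix.submatrix_apply, Equiv.symm_apply_apply,
      Equiv.symm_apply_apply, Matrix.comp_apply, Matrix.diagonal_apply_eq]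
  · intro j _ hji
    refine Finset.sum_eq_zero fun b _ => ?_
    rw [Matrix.reindex_apply, Matrix.submatrix_apply, Equiv.symm_apply_apply,
      Equiv.symm_apply_apply, Matrix.comp_apply, Matrix.diagonal_apply_ne _ (Ne.symm hji),
      Matrix.zero_apply, zero_mul]
  · intro hi
    exact absurd (Finset.mem_univ i) hi

end FramedGaloisRep

end Blocks

/-! ### Mackey's criterion relative to a subgroup `Λ ≤ Γ_K` -/

section Subgroup

variable (K : Type u) {F : Type v} [Field K] [Field F] [Algebra K F] [CharZero K]
  [FiniteDimensional K F] [IsGalois K F] [CharZero F]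
  {A : Type w} [Field A] [TopologicalSpace A] {d m : ℕ}

namespace FramedGaloisRep

/-- **Mackey's irreducibility criterion relative to a subgroup (matrix form, any field).**  Let
`F/K` be finite Galois of degree `d` (characteristic `0`), `A` a field, `ψ : Γ_F →ₜ* GL_m(A)`,
`Λ ≤ Γ_K` a subgroup and `Λ_F = res⁻¹(Λ) ≤ Γ_F`.  Suppose: (i) for every `i`, the only subspaces
of `A^m` stable under the conjugate `ψ^{rᵢ⁻¹}` (`outerConj`, `rᵢ = absGaloisCosetRep K F hd i`)
restricted to `Λ_F` are `0` and `A^m`; (ii) for `i ≠ j` no `P ∈ GL_m(A)` conjugates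
`ψ^{rᵢ⁻¹}|_{Λ_F}` into `ψ^{rⱼ⁻¹}|_{Λ_F}`; (iii) for all `i, k` some element of `Λ` has the form
`r_k · res(σ) · rᵢ⁻¹`.  Then every non-zero subspace `W ≤ A^{dm}` stable under `Ind(ψ)(Λ)`
(`ψ.induce K hd`) is all of `A^{dm}`.  Proof: module docstring (block projections are
`Λ_F`-equivariant; a minimal non-zero `Λ_F`-stable subspace of `W` is a full block by (i), (ii);
(iii) moves it to every block).  For `Λ = Γ_K` this is Serre §7.4 Cor. of Prop. 23 ("sufficient"
half); for `Λ = res(Γ_L)` it is that corollary applied to Mackey's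
`Res_{Γ_L} Ind ψ ≅ Ind_{Γ_{FL}}^{Γ_L} Res ψ` (§7.3 Prop. 22).
[cite: SerreLinearRepresentations1977, §7.4 Prop. 23 and Cor.; §7.3 Prop. 22] -/
theorem induce_stable_eq_top_of_subgroup (hd : Module.finrank K F = d)
    (ψ : FramedGaloisRep F A m) (Λ : Subgroup (absoluteGaloisGroup K))
    (hirr : ∀ (i : Fin d) (I : Submodule A (Fin m → A)),
      (∀ σ : absoluteGaloisGroup F, absGaloisRestrict K F σ ∈ Λ → ∀ v ∈ I,
        ((ψ.outerConj (absGaloisCosetRep K F hd i)⁻¹ σ : GL (Fin m) A) :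
          Matrix (Fin m) (Fin m) A) *ᵥ v ∈ I) → I ≠ ⊥ → I = ⊤)
    (hreg : ∀ i j : Fin d, i ≠ j → ∀ P : GL (Fin m) A,
      ¬ ∀ σ : absoluteGaloisGroup F, absGaloisRestrict K F σ ∈ Λ →
        ψ.outerConj (absGaloisCosetRep K F hd j)⁻¹ σ =
          P * ψ.outerConj (absGaloisCosetRep K F hd i)⁻¹ σ * P⁻¹)
    (htrans : ∀ i k : Fin d, ∃ g ∈ Λ, ∃ σ : absoluteGaloisGroup F,
      g = absGaloisCosetRep K F hd k * absGaloisRestrict K F σ * (absGaloisCosetRep K F hd i)⁻¹)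
    (W : Submodule A (Fin (d * m) → A))
    (hW : ∀ g ∈ Λ, ∀ w ∈ W,
      ((ψ.induce K hd g : GL (Fin (d * m)) A) : Matrix (Fin (d * m)) (Fin (d * m)) A) *ᵥ w ∈ W)
    (hW0 : W ≠ ⊥) : W = ⊤ := by
  -- adapted from Summit.Langlands.Langlands.Theorems.IrreducibleOffSector.isIrreducible_induce_of_not_conj
  classical
  -- notation: matrices of `Ind ψ`, the conjugates, block projections and embeddings
  let M : absoluteGaloisGroup K → Matrix (Fin (d * m)) (Fin (d * m)) A := fun g =>
    ((ψ.induce K hd g : GL (Fin (d * m)) A) : Matrix (Fin (d * m)) (Fin (d * m)) A)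
  let C : Fin d → absoluteGaloisGroup F → Matrix (Fin m) (Fin m) A := fun i σ =>
    ((ψ.outerConj (absGaloisCosetRep K F hd i)⁻¹ σ : GL (Fin m) A) : Matrix (Fin m) (Fin m) A)
  let proj : Fin d → (Fin (d * m) → A) →ₗ[A] (Fin m → A) := fun i =>
    LinearMap.funLeft A A fun a => finProdFinEquiv (i, a)
  let emb : Fin d → (Fin m → A) → (Fin (d * m) → A) := fun i v x =>
    if (finProdFinEquiv.symm x).1 = i then v (finProdFinEquiv.symm x).2 else 0
  have hproj : ∀ i w a, proj i w a = w (finProdFinEquiv (i, a)) := fun i w a => rfl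
  -- block calculus
  have hemb : ∀ i v j a, emb i v (finProdFinEquiv (j, a)) = if j = i then v a else 0 := by
    intro i v j a
    show (if (finProdFinEquiv.symm (finProdFinEquiv (j, a))).1 = i then
      v (finProdFinEquiv.symm (finProdFinEquiv (j, a))).2 else 0) = _
    rw [Equiv.symm_apply_apply]
  have hpe : ∀ i v, proj i (emb i v) = v := fun i v => by
    funext a; rw [hproj, hemb, if_pos rfl]
  have hrecon : ∀ (i) (u : Fin (d * m) → A), (∀ j, j ≠ i → proj j u = 0) →
      u = emb i (proj i u) := by
    intro i u hu
    funext x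
    obtain ⟨⟨j, a⟩, rfl⟩ := finProdFinEquiv.surjective x
    rw [hemb]
    by_cases hji : j = i
    · subst hji; rw [if_pos rfl, hproj]
    · have := congrFun (hu j hji) a
      rw [hproj] at this
      rw [if_neg hji, this, Pi.zero_apply]
  have hsum : ∀ w : Fin (d * m) → A, w = ∑ k, emb k (proj k w) := by
    intro w
    funext x
    obtain ⟨⟨j, a⟩, rfl⟩ := finProdFinEquiv.surjective x
    rw [Finset.sum_apply]
    simp only [hemb, hproj]
    rw [Finset.sum_ite_eq Finset.univ j, if_pos (Finset.mem_univ _)]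
  -- `Γ_F`-equivariance of the projections, and the translations between blocks
  have hequiv : ∀ (i) (σ : absoluteGaloisGroup F) (w : Fin (d * m) → A),
      proj i (M (absGaloisRestrict K F σ) *ᵥ w) = C i σ *ᵥ proj i w := by
    intro i σ w
    funext a
    rw [hproj]
    exact congrFun (induce_absGaloisRestrict_mulVec_block K hd ψ σ w i) a
  have htrans' : ∀ (i k) (σ : absoluteGaloisGroup F) (v : Fin m → A),
      M (absGaloisCosetRep K F hd k * absGaloisRestrict K F σ * (absGaloisCosetRep K F hd i)⁻¹) *ᵥ
          emb i v =
        emb k (((ψ σ : GL (Fin m) A) : Matrix (Fin m) (Fin m) A) *ᵥ v) :=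
    fun i k σ v => induce_mulVec_blockVec_of_eq K hd ψ i k σ v
  -- `Λ_F`-stable non-zero subspaces of `W`, and one of minimal dimension
  let S : Set (Submodule A (Fin (d * m) → A)) := fun U =>
    U ≤ W ∧ U ≠ ⊥ ∧ ∀ σ : absoluteGaloisGroup F, absGaloisRestrict K F σ ∈ Λ →
      ∀ u ∈ U, M (absGaloisRestrict K F σ) *ᵥ u ∈ U
  have hWS : W ∈ S := ⟨le_rfl, hW0, fun σ hσ u hu => hW _ hσ u hu⟩
  have hex : ∃ k, ∃ U ∈ S, Module.finrank A U = k := ⟨_, _, hWS, rfl⟩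
  obtain ⟨U, hUS, hUk⟩ := Nat.find_spec hex
  have hUmin : ∀ U' ∈ S, U' ≤ U → U' = U := by
    intro U' hU'S hle
    apply Submodule.eq_of_le_of_finrank_eq hle
    apply le_antisymm (Submodule.finrank_mono hle)
    rw [hUk]
    exact Nat.find_min' hex ⟨U', hU'S, rfl⟩
  obtain ⟨hUW, hU0, hUstab⟩ := hUS
  -- a non-zero vector of `U` and a block where it is visible
  obtain ⟨u, huU, hu0⟩ := (Submodule.ne_bot_iff U).1 hU0
  have hdpos : 0 < d := hd ▸ Module.finrank_pos
  obtain ⟨i, hi⟩ : ∃ i, proj i u ≠ 0 := by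
    by_contra hcon
    rw [not_exists] at hcon
    simp only [not_not] at hcon
    apply hu0
    rw [hrecon ⟨0, hdpos⟩ u fun j _ => hcon j, hcon ⟨0, hdpos⟩]
    funext x
    obtain ⟨⟨j, a⟩, rfl⟩ := finProdFinEquiv.surjective x
    rw [hemb, Pi.zero_apply, Pi.zero_apply, ite_self]
  -- on `U`, a projection is either zero or injective with image everything
  have hdich : ∀ j, (∃ u' ∈ U, proj j u' ≠ 0) →
      (∀ u' ∈ U, proj j u' = 0 → u' = 0) ∧ U.map (proj j) = ⊤ := by
    intro j hj
    constructor
    · -- the kernel `U ⊓ ker (proj j)` is stable and proper, hence zero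
      intro u' hu' hpu'
      by_contra hne
      have hKS : U ⊓ LinearMap.ker (proj j) ∈ S := by
        refine ⟨inf_le_left.trans hUW, ?_, ?_⟩
        · rw [Submodule.ne_bot_iff]
          exact ⟨u', ⟨hu', LinearMap.mem_ker.2 hpu'⟩, hne⟩
        · intro σ hσ x hx
          refine ⟨hUstab σ hσ x hx.1, LinearMap.mem_ker.2 ?_⟩
          rw [hequiv, LinearMap.mem_ker.1 hx.2, Matrix.mulVec_zero]
      have hK := hUmin _ hKS inf_le_left
      obtain ⟨u'', hu'', hpu''⟩ := hj
      have : u'' ∈ U ⊓ LinearMap.ker (proj j) := hK.symm ▸ hu''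
      exact hpu'' (LinearMap.mem_ker.1 this.2)
    · refine hirr j _ (fun σ hσ v hv => ?_) ?_
      · obtain ⟨x, hx, rfl⟩ := Submodule.mem_map.1 hv
        exact Submodule.mem_map.2 ⟨_, hUstab σ hσ x hx, hequiv j σ x⟩
      · rw [Submodule.ne_bot_iff]
        obtain ⟨u'', hu'', hpu''⟩ := hj
        exact ⟨_, Submodule.mem_map.2 ⟨u'', hu'', rfl⟩, hpu''⟩
  obtain ⟨hinj_i, hsurj_i⟩ := hdich i ⟨u, huU, hi⟩
  -- every other projection vanishes on `U` (non-conjugacy of the conjugates on `Λ_F`)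
  have hvan : ∀ j, j ≠ i → ∀ u' ∈ U, proj j u' = 0 := by
    intro j hji u' hu'
    by_contra hne
    obtain ⟨hinj_j, hsurj_j⟩ := hdich j ⟨u', hu', hne⟩
    -- the two isomorphisms `U ≅ A^m`
    have hbij : ∀ k, (∀ x ∈ U, proj k x = 0 → x = 0) → U.map (proj k) = ⊤ →
        Function.Bijective ((proj k).domRestrict U) := by
      intro k hinjk hsurjk
      constructor
      · intro x y hxy
        apply Subtype.ext
        have := hinjk (x - y) (U.sub_mem x.2 y.2) (by
          rw [map_sub, sub_eq_zero]; exact hxy)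
        exact sub_eq_zero.1 this
      · intro v
        have hv : v ∈ U.map (proj k) := hsurjk ▸ Submodule.mem_top
        obtain ⟨x, hx, rfl⟩ := Submodule.mem_map.1 hv
        exact ⟨⟨x, hx⟩, rfl⟩
    let Pi : U ≃ₗ[A] (Fin m → A) := LinearEquiv.ofBijective _ (hbij i hinj_i hsurj_i)
    let Pj : U ≃ₗ[A] (Fin m → A) := LinearEquiv.ofBijective _ (hbij j hinj_j hsurj_j)
    have hPi : ∀ x : U, Pi x = proj i x := fun x => rfl
    have hPj : ∀ x : U, Pj x = proj j x := fun x => rfl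
    let T : (Fin m → A) ≃ₗ[A] (Fin m → A) := Pi.symm.trans Pj
    -- `T` intertwines `C i` and `C j` on `Λ_F`
    have hT : ∀ σ : absoluteGaloisGroup F, absGaloisRestrict K F σ ∈ Λ → ∀ v : Fin m → A,
        T (C i σ *ᵥ v) = C j σ *ᵥ T v := by
      intro σ hσ v
      obtain ⟨x, rfl⟩ := Pi.surjective v
      have hx' : M (absGaloisRestrict K F σ) *ᵥ (x : Fin (d * m) → A) ∈ U := hUstab σ hσ x x.2
      have h1 : C i σ *ᵥ Pi x = Pi ⟨_, hx'⟩ := by rw [hPi, hPi, hequiv]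
      rw [h1]
      change Pj (Pi.symm (Pi _)) = C j σ *ᵥ Pj (Pi.symm (Pi x))
      rw [LinearEquiv.symm_apply_apply, LinearEquiv.symm_apply_apply, hPj, hPj]
      exact hequiv j σ x
    -- as matrices: `Q (C i σ) = (C j σ) Q` on `Λ_F`, `Q` invertible
    have hTid : (T : (Fin m → A) →ₗ[A] (Fin m → A)) ∘ₗ (T.symm : (Fin m → A) →ₗ[A] (Fin m → A)) =
        LinearMap.id := LinearMap.ext fun v => T.apply_symm_apply v
    have hTid' : (T.symm : (Fin m → A) →ₗ[A] (Fin m → A)) ∘ₗ (T : (Fin m → A) →ₗ[A] (Fin m → A)) =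
        LinearMap.id := LinearMap.ext fun v => T.symm_apply_apply v
    let Q : GL (Fin m) A :=
      ⟨LinearMap.toMatrix' (T : (Fin m → A) →ₗ[A] (Fin m → A)),
        LinearMap.toMatrix' (T.symm : (Fin m → A) →ₗ[A] (Fin m → A)),
        by rw [← LinearMap.toMatrix'_comp, hTid, LinearMap.toMatrix'_id],
        by rw [← LinearMap.toMatrix'_comp, hTid', LinearMap.toMatrix'_id]⟩
    have hQ : ∀ σ : absoluteGaloisGroup F, absGaloisRestrict K F σ ∈ Λ →
        (Q : Matrix (Fin m) (Fin m) A) * C i σ = C j σ * (Q : Matrix (Fin m) (Fin m) A) := by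
      intro σ hσ
      have h : (T : (Fin m → A) →ₗ[A] (Fin m → A)) ∘ₗ Matrix.toLin' (C i σ) =
          Matrix.toLin' (C j σ) ∘ₗ (T : (Fin m → A) →ₗ[A] (Fin m → A)) :=
        LinearMap.ext fun v => by
          rw [LinearMap.comp_apply, LinearMap.comp_apply, Matrix.toLin'_apply, Matrix.toLin'_apply]
          exact hT σ hσ v
      have h' := congrArg LinearMap.toMatrix' h
      rw [LinearMap.toMatrix'_comp, LinearMap.toMatrix'_comp, LinearMap.toMatrix'_toLin',
        LinearMap.toMatrix'_toLin'] at h'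
      exact h'
    refine hreg i j (Ne.symm hji) Q fun σ hσ => Units.ext ?_
    rw [Units.val_mul, Units.val_mul]
    show C j σ = (Q : Matrix (Fin m) (Fin m) A) * C i σ * ((Q⁻¹ : GL (Fin m) A) : Matrix (Fin m) (Fin m) A)
    rw [hQ σ hσ, mul_assoc, ← Units.val_mul, mul_inv_cancel, Units.val_one, mul_one]
  -- hence `U` is the full block `V_i`, inside `W`
  have hblock : ∀ v : Fin m → A, emb i v ∈ W := by
    intro v
    have hv : v ∈ U.map (proj i) := hsurj_i ▸ Submodule.mem_top
    obtain ⟨x, hx, rfl⟩ := Submodule.mem_map.1 hv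
    rw [← hrecon i x fun j hji => hvan j hji x hx]
    exact hUW hx
  -- every block lies in `W` (hypothesis (iii)), and the blocks span
  have hall : ∀ k (v : Fin m → A), emb k v ∈ W := by
    intro k v
    obtain ⟨g, hg, σ, rfl⟩ := htrans i k
    have hmem := hW _ hg _ (hblock ((((ψ σ)⁻¹ : GL (Fin m) A) : Matrix (Fin m) (Fin m) A) *ᵥ v))
    rw [htrans', Matrix.mulVec_mulVec, ← Units.val_mul, mul_inv_cancel, Units.val_one,
      Matrix.one_mulVec] at hmem
    exact hmem
  rw [eq_top_iff]
  rintro w -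
  rw [hsum w]
  exact W.sum_mem fun k _ => hall k _

/-- **Mackey's irreducibility criterion for `Ind_{Γ_F}^{Γ_K} ψ` (matrix form, any field).**  For
`F/K` finite Galois of degree `d` (characteristic `0`), `A` a field and `ψ : Γ_F →ₜ* GL_m(A)`
IRREDUCIBLE whose conjugates `ψ^{rᵢ⁻¹}` by the chosen coset representatives are pairwise
non-conjugate (`FramedRep.conj`), `Ind(ψ) = ψ.induce K hd : Γ_K →ₜ* GL_{dm}(A)` is irreducible.
(Serre §7.4, Cor. of Prop. 23, "sufficient" half, for `H = Γ_F ◁ Γ_K`; Literature twin of the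
Summits-side `IrreducibleOffSector.isIrreducible_induce_of_not_conj`.)
[cite: SerreLinearRepresentations1977, §7.4 Prop. 23 and Cor.] -/
theorem isIrreducible_induce_of_forall_ne_conj [IsTopologicalRing A] (hd : Module.finrank K F = d)
    (ψ : FramedGaloisRep F A m) (hirr : FramedRep.IsIrreducible ψ)
    (hreg : ∀ i j : Fin d, i ≠ j → ∀ P : GL (Fin m) A,
      ψ.outerConj (absGaloisCosetRep K F hd j)⁻¹ ≠
        FramedRep.conj P (ψ.outerConj (absGaloisCosetRep K F hd i)⁻¹)) :
    FramedRep.IsIrreducible (ψ.induce K hd) := by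
  classical
  have hm : 0 < m := hirr.rank_pos
  have hdpos : 0 < d := hd ▸ Module.finrank_pos
  haveI : Nonempty (Fin (d * m)) := ⟨⟨0, Nat.mul_pos hdpos hm⟩⟩
  have hbt : (⊥ : Submodule A (Fin (d * m) → A)) ≠ ⊤ := bot_ne_top
  haveI : Nontrivial (Subrepresentation (FramedRep.toRepresentation (ψ.induce K hd))) :=
    ⟨⟨⊥, ⊤, fun h => hbt (congrArg Subrepresentation.toSubmodule h)⟩⟩
  refine ⟨fun W' => ?_⟩
  by_cases hW' : W' = ⊥
  · exact Or.inl hW'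
  right
  apply Subrepresentation.toSubmodule_injective
  change W'.toSubmodule = ⊤
  refine induce_stable_eq_top_of_subgroup K hd ψ ⊤ ?_ ?_ ?_ W'.toSubmodule ?_
    (fun h => hW' (Subrepresentation.toSubmodule_injective h))
  · -- (i): irreducibility of `ψ`, transported along the bijection `θ_{rᵢ⁻¹}`
    intro i I hI hI0
    let I' : Subrepresentation (FramedRep.toRepresentation ψ) :=
      ⟨I, fun σ' v hv => by
        obtain ⟨σ, rfl⟩ := (absGaloisOuterConj_bijective K F (absGaloisCosetRep K F hd i)⁻¹).2 σ'
        exact hI σ (Subgroup.mem_top _) v hv⟩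
    haveI : Representation.IsIrreducible (FramedRep.toRepresentation ψ) := hirr
    rcases IsSimpleOrder.eq_bot_or_eq_top I' with h | h
    · exact absurd (congrArg Subrepresentation.toSubmodule h) hI0
    · exact congrArg Subrepresentation.toSubmodule h
  · -- (ii)
    intro i j hij P hP
    exact hreg i j hij P (ContinuousMonoidHom.ext fun σ => by
      rw [FramedRep.conj_apply]; exact hP σ (Subgroup.mem_top _))
  · -- (iii): `r_k rᵢ⁻¹ ∈ Γ_K`
    intro i k
    exact ⟨absGaloisCosetRep K F hd k * absGaloisRestrict K F 1 * (absGaloisCosetRep K F hd i)⁻¹,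
      Subgroup.mem_top _, 1, rfl⟩
  · intro g _ w hw
    exact W'.apply_mem_toSubmodule g hw

/-- Hypothesis (iii) of `induce_stable_eq_top_of_subgroup` from `Λ · res(Γ_F) = Γ_K`: every
`r_k rᵢ⁻¹` is `λ · res(σ')`, and `λ = r_k · res(θ_{rᵢ⁻¹}(σ'⁻¹)) · rᵢ⁻¹` (`res(Γ_F)` is normal).
[folklore] -/
theorem exists_mem_eq_cosetRep_mul_of_sup_eq_top (hd : Module.finrank K F = d)
    (Λ : Subgroup (absoluteGaloisGroup K)) (hsup : Λ ⊔ (absGaloisRestrict K F).range = ⊤)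
    (i k : Fin d) :
    ∃ g ∈ Λ, ∃ σ : absoluteGaloisGroup F,
      g = absGaloisCosetRep K F hd k * absGaloisRestrict K F σ * (absGaloisCosetRep K F hd i)⁻¹ := by
  haveI := normal_range_absGaloisRestrict K F
  have hmem : absGaloisCosetRep K F hd k * (absGaloisCosetRep K F hd i)⁻¹ ∈
      ((Λ ⊔ (absGaloisRestrict K F).range : Subgroup (absoluteGaloisGroup K)) :
        Set (absoluteGaloisGroup K)) := by
    rw [hsup]; exact Subgroup.mem_top _
  rw [Subgroup.mul_normal] at hmem
  obtain ⟨g, hg, n, ⟨σ', rfl⟩, hgn⟩ := Set.mem_mul.1 hmem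
  refine ⟨g, hg, absGaloisOuterConj K F (absGaloisCosetRep K F hd i)⁻¹ σ'⁻¹, ?_⟩
  rw [absGaloisRestrict_absGaloisOuterConj, inv_inv, map_inv]
  have hg' : g = absGaloisCosetRep K F hd k * (absGaloisCosetRep K F hd i)⁻¹ *
      (absGaloisRestrict K F σ')⁻¹ := by
    rw [← hgn]
    exact (mul_inv_cancel_right _ _).symm
  rw [hg']
  group

/-- **`(Ind_{Γ_F}^{Γ_K} ψ)|_{Γ_L}` is irreducible** (Mackey, any field of coefficients).  Let `F/K`
be finite Galois of degree `d`, `L/K` an extension with `Λ = res(Γ_L)` NORMAL in `Γ_K` (e.g. `L/K`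
Galois) and `Λ · res(Γ_F) = Γ_K` (i.e. `L ∩ F = K`), `A` a field, `m ≥ 1`, and `ψ : Γ_F →ₜ* GL_m(A)`
such that, with `Λ_F = res⁻¹(Λ) ≤ Γ_F` (`= Γ_{FL}`): (i) `ψ|_{Λ_F}` has no stable subspace other
than `0`, `A^m`; (ii) for `g ∉ res(Γ_F)`, `ψ^g|_{Λ_F}` (`outerConj`) is not conjugate to `ψ|_{Λ_F}`.
Then `((ψ.induce K hd).restrictField L)` is irreducible.  (Serre §7.3 Prop. 22:
`Res_{Γ_L} Ind_{Γ_F}^{Γ_K} ψ ≅ Ind_{Γ_{FL}}^{Γ_L} Res ψ`, one double coset; then §7.4 Cor.)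
[cite: SerreLinearRepresentations1977, §7.3 Prop. 22, §7.4 Cor.] -/
theorem isIrreducible_restrictField_induce (hd : Module.finrank K F = d)
    (ψ : FramedGaloisRep F A m) (hm : 0 < m) (L : Type*) [Field L] [Algebra K L]
    (hnormal : ((absGaloisRestrict K L).range : Subgroup (absoluteGaloisGroup K)).Normal)
    (hsup : (absGaloisRestrict K L).range ⊔ (absGaloisRestrict K F).range = ⊤)
    (hirr : ∀ I : Submodule A (Fin m → A),
      (∀ σ : absoluteGaloisGroup F, absGaloisRestrict K F σ ∈ (absGaloisRestrict K L).range →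
        ∀ v ∈ I, ((ψ σ : GL (Fin m) A) : Matrix (Fin m) (Fin m) A) *ᵥ v ∈ I) → I ≠ ⊥ → I = ⊤)
    (hreg : ∀ g : absoluteGaloisGroup K, g ∉ (absGaloisRestrict K F).range → ∀ P : GL (Fin m) A,
      ¬ ∀ σ : absoluteGaloisGroup F, absGaloisRestrict K F σ ∈ (absGaloisRestrict K L).range →
        ψ.outerConj g σ = P * ψ σ * P⁻¹) :
    FramedRep.IsIrreducible ((ψ.induce K hd).restrictField L) := by
  classical
  set Λ : Subgroup (absoluteGaloisGroup K) := (absGaloisRestrict K L).range with hΛ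
  have hdpos : 0 < d := hd ▸ Module.finrank_pos
  haveI : Nonempty (Fin (d * m)) := ⟨⟨0, Nat.mul_pos hdpos hm⟩⟩
  have hbt : (⊥ : Submodule A (Fin (d * m) → A)) ≠ ⊤ := bot_ne_top
  haveI : Nontrivial (Subrepresentation
      (FramedRep.toRepresentation ((ψ.induce K hd).restrictField L))) :=
    ⟨⟨⊥, ⊤, fun h => hbt (congrArg Subrepresentation.toSubmodule h)⟩⟩
  refine ⟨fun W' => ?_⟩
  by_cases hW' : W' = ⊥
  · exact Or.inl hW'
  right
  apply Subrepresentation.toSubmodule_injective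
  change W'.toSubmodule = ⊤
  refine induce_stable_eq_top_of_subgroup K hd ψ Λ ?_ ?_
    (exists_mem_eq_cosetRep_mul_of_sup_eq_top K hd Λ hsup) W'.toSubmodule ?_
    (fun h => hW' (Subrepresentation.toSubmodule_injective h))
  · -- (i): `θ_{rᵢ⁻¹}` maps `Λ_F` onto itself (`Λ` normal)
    intro i I hI hI0
    refine hirr I (fun σ' hσ' v hv => ?_) hI0
    obtain ⟨σ, rfl⟩ := (absGaloisOuterConj_bijective K F (absGaloisCosetRep K F hd i)⁻¹).2 σ'
    refine hI σ ?_ v hv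
    have h1 := hnormal.conj_mem _ hσ' (absGaloisCosetRep K F hd i)
    rw [absGaloisRestrict_absGaloisOuterConj] at h1
    convert h1 using 1
    group
  · -- (ii): conjugacy of `ψ^{rⱼ⁻¹}`, `ψ^{rᵢ⁻¹}` on `Λ_F` is conjugacy of `ψ^{rⱼ⁻¹ rᵢ}`, `ψ`
    intro i j hij P hP
    have hg : (absGaloisCosetRep K F hd j)⁻¹ * absGaloisCosetRep K F hd i ∉
        (absGaloisRestrict K F).range := fun hmem =>
      hij ((absGaloisCosetRep_bijective K F hd).1 (QuotientGroup.eq.2 hmem)).symm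
    refine hreg _ hg P fun σ₀ hσ₀ => ?_
    have hσ : absGaloisRestrict K F (absGaloisOuterConj K F (absGaloisCosetRep K F hd i) σ₀) ∈ Λ := by
      rw [absGaloisRestrict_absGaloisOuterConj]
      exact hnormal.conj_mem _ hσ₀ _
    have h := hP _ hσ
    simp only [FramedGaloisRep.outerConj_apply] at h ⊢
    rw [absGaloisOuterConj_inv_apply_apply, ← absGaloisOuterConj_mul_apply] at h
    exact h
  · rintro _ ⟨g', rfl⟩ w hw
    exact W'.apply_mem_toSubmodule g' hw

end FramedGaloisRep

end Subgroup

/-! ### Absolutely irreducible forms -/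

section Absolute

variable (K : Type u) {F : Type v} [Field K] [Field F] [Algebra K F] [CharZero K]
  [FiniteDimensional K F] [IsGalois K F] [CharZero F]
  {A : Type w} [Field A] [TopologicalSpace A] {d m : ℕ}

namespace FramedGaloisRep

omit [IsGalois K F] [CharZero F] [CharZero K] [FiniteDimensional K F] in
/-- Restriction to `Γ_L` commutes with base change (both are compositions). [folklore] -/
theorem restrictField_baseChange {B : Type*} [CommRing B] [TopologicalSpace B] (f : A →+* B)
    (hf : Continuous f) (L : Type*) [Field L] [Algebra K L] {n : ℕ} (ρ : FramedGaloisRep K A n) :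
    FramedGaloisRep.restrictField L (FramedRep.baseChange f hf ρ) =
      FramedRep.baseChange f hf (ρ.restrictField L) :=
  rfl

omit [CharZero K] [FiniteDimensional K F] in
/-- Conjugation `outerConj` commutes with base change (both are compositions). [folklore] -/
theorem outerConj_baseChange {B : Type*} [CommRing B] [TopologicalSpace B]
    (f : A →+* B) (hf : Continuous f) (τ : absoluteGaloisGroup K) (ρ : FramedGaloisRep F A m) :
    FramedGaloisRep.outerConj τ (FramedRep.baseChange f hf ρ : FramedGaloisRep F B m) =
      FramedRep.baseChange f hf (ρ.outerConj τ) :=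
  rfl

omit [IsGalois K F] [CharZero F] [CharZero K] [FiniteDimensional K F] [TopologicalSpace A] in
/-- The matrix of `GL_n(f)(X)` is the entrywise image of the matrix of `X`. [folklore] -/
theorem coe_generalLinearGroup_map {B : Type*} [CommRing B] (f : A →+* B) {n : ℕ}
    (X : GL (Fin n) A) :
    ((Matrix.GeneralLinearGroup.map f X : GL (Fin n) B) : Matrix (Fin n) (Fin n) B) =
      (X : Matrix (Fin n) (Fin n) A).map f :=
  rfl

/-- **Mackey's criterion, absolutely irreducible form.**  For `F/K` finite Galois of degree `d`,
`A` a field and `ψ : Γ_F →ₜ* GL_m(A)` ABSOLUTELY irreducible such that for `i ≠ j` the conjugates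
`ψ^{rᵢ⁻¹}`, `ψ^{rⱼ⁻¹}` have different characteristic polynomials at some `σ ∈ Γ_F` (so that they
stay non-conjugate over every extension of `A`), `Ind(ψ) = ψ.induce K hd` is absolutely
irreducible (`Ind` commutes with base change, `induce_baseChange`).
[cite: SerreLinearRepresentations1977, §7.4 Prop. 23 and Cor.] -/
theorem isAbsolutelyIrreducible_induce_of_charpoly_ne (hd : Module.finrank K F = d)
    (ψ : FramedGaloisRep F A m) (hirr : FramedRep.IsAbsolutelyIrreducible ψ)
    (hreg : ∀ i j : Fin d, i ≠ j → ∃ σ : absoluteGaloisGroup F,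
      FramedRep.charpoly (ψ.outerConj (absGaloisCosetRep K F hd i)⁻¹) σ ≠
        FramedRep.charpoly (ψ.outerConj (absGaloisCosetRep K F hd j)⁻¹) σ) :
    FramedRep.IsAbsolutelyIrreducible (ψ.induce K hd) := by
  intro B _ f
  letI : TopologicalSpace B := ⊤
  haveI : ContinuousAdd B := ⟨continuous_top⟩
  haveI : ContinuousMul B := ⟨continuous_top⟩
  haveI : ContinuousNeg B := ⟨continuous_top⟩
  haveI : IsTopologicalSemiring B := ⟨⟩
  haveI : IsTopologicalRing B := ⟨⟩
  have hf : Continuous f := continuous_top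
  change FramedRep.IsIrreducible (FramedRep.baseChange f hf (ψ.induce K hd))
  rw [← induce_baseChange]
  refine isIrreducible_induce_of_forall_ne_conj K hd _ (hirr B f) fun i j hij P hP => ?_
  obtain ⟨σ, hσ⟩ := hreg i j hij
  apply hσ
  have h := congrArg (fun ρ : FramedGaloisRep F B m => FramedRep.charpoly ρ σ) hP
  simp only [FramedRep.charpoly, FramedRep.conj_apply, Units.val_mul, Matrix.coe_units_inv,
    Matrix.charpoly_units_conj, FramedGaloisRep.outerConj_apply, FramedRep.baseChange_apply,
    coe_generalLinearGroup_map, Matrix.charpoly_map] at h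
  exact (Polynomial.map_injective f f.injective h).symm

/-- **`(Ind_{Γ_F}^{Γ_K} ψ)|_{Γ_L}` is absolutely irreducible** (Mackey).  Let `F/K` be finite Galois
of degree `d`, `L/K` with `res(Γ_L)` normal in `Γ_K` and `res(Γ_L) · res(Γ_F) = Γ_K`, and `M/F` an
extension presenting `Γ_{FL}`: `res(Γ_M) = {σ ∈ Γ_F : res(σ) ∈ res(Γ_L)}` (hypothesis `hM`; e.g.
`L = K(ζ)`, `M = F(ζ)`).  If `ψ|_{Γ_M}` is ABSOLUTELY irreducible and, for every
`g ∈ Γ_K ∖ res(Γ_F)`, `ψ|_{Γ_M}` and `ψ^g|_{Γ_M}` have different characteristic polynomials at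
some element, then `((ψ.induce K hd).restrictField L)` is absolutely irreducible.
[cite: SerreLinearRepresentations1977, §7.3 Prop. 22, §7.4 Cor.] -/
theorem isAbsolutelyIrreducible_restrictField_induce (hd : Module.finrank K F = d)
    (ψ : FramedGaloisRep F A m) (L : Type*) [Field L] [Algebra K L]
    (hnormal : ((absGaloisRestrict K L).range : Subgroup (absoluteGaloisGroup K)).Normal)
    (hsup : (absGaloisRestrict K L).range ⊔ (absGaloisRestrict K F).range = ⊤)
    (M : Type*) [Field M] [Algebra F M]
    (hM : ∀ σ : absoluteGaloisGroup F,
      σ ∈ (absGaloisRestrict F M).range ↔ absGaloisRestrict K F σ ∈ (absGaloisRestrict K L).range)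
    (hirr : FramedRep.IsAbsolutelyIrreducible (ψ.restrictField M))
    (hreg : ∀ g : absoluteGaloisGroup K, g ∉ (absGaloisRestrict K F).range →
      ∃ σ : absoluteGaloisGroup M, FramedRep.charpoly (ψ.restrictField M) σ ≠
        FramedRep.charpoly ((ψ.outerConj g).restrictField M) σ) :
    FramedRep.IsAbsolutelyIrreducible ((ψ.induce K hd).restrictField L) := by
  intro B _ f
  letI : TopologicalSpace B := ⊤
  haveI : ContinuousAdd B := ⟨continuous_top⟩
  haveI : ContinuousMul B := ⟨continuous_top⟩
  haveI : ContinuousNeg B := ⟨continuous_top⟩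
  haveI : IsTopologicalSemiring B := ⟨⟩
  haveI : IsTopologicalRing B := ⟨⟩
  have hf : Continuous f := continuous_top
  have hm : 0 < m := (hirr.isIrreducible).rank_pos
  change FramedRep.IsIrreducible (FramedRep.baseChange f hf ((ψ.induce K hd).restrictField L))
  rw [← restrictField_baseChange, ← induce_baseChange]
  refine isIrreducible_restrictField_induce K hd _ hm L hnormal hsup ?_ ?_
  · -- (i) from absolute irreducibility of `ψ|_{Γ_M}`
    intro I hI hI0
    let I' : Subrepresentation (FramedRep.baseChangeRepresentation f (ψ.restrictField M)) :=
      ⟨I, fun σ'' v hv => hI _ ((hM _).1 ⟨σ'', rfl⟩) v hv⟩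
    haveI : Representation.IsIrreducible
        (FramedRep.baseChangeRepresentation f (ψ.restrictField M)) := hirr B f
    rcases IsSimpleOrder.eq_bot_or_eq_top I' with h | h
    · exact absurd (congrArg Subrepresentation.toSubmodule h) hI0
    · exact congrArg Subrepresentation.toSubmodule h
  · -- (ii) from different characteristic polynomials
    intro g hg P hP
    obtain ⟨σ'', hne⟩ := hreg g hg
    apply hne
    have h := congrArg (fun X : GL (Fin m) B => (X : Matrix (Fin m) (Fin m) B).charpoly)
      (hP _ ((hM _).1 ⟨σ'', rfl⟩))
    simp only [Units.val_mul, Matrix.coe_units_inv, Matrix.charpoly_units_conj,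
      FramedGaloisRep.outerConj_apply, FramedRep.baseChange_apply, coe_generalLinearGroup_map,
      Matrix.charpoly_map] at h
    exact (Polynomial.map_injective f f.injective h).symm

omit [IsGalois K F] [CharZero F] in
/-- For `[F : K] = 2`, a subgroup `Λ ≤ Γ_K` not contained in `res(Γ_F)` satisfies
`Λ · res(Γ_F) = Γ_K` (`res(Γ_F)` has index `2`). [folklore] -/
theorem sup_range_absGaloisRestrict_eq_top_of_finrank_eq_two (hd : Module.finrank K F = 2)
    (Λ : Subgroup (absoluteGaloisGroup K)) (hΛ : ¬ Λ ≤ (absGaloisRestrict K F).range) :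
    Λ ⊔ (absGaloisRestrict K F).range = ⊤ := by
  set N : Subgroup (absoluteGaloisGroup K) := (absGaloisRestrict K F).range with hN
  have hidx : N.index = 2 := (nat_card_quotient_range_absGaloisRestrict K F).trans hd
  have hle : N ≤ Λ ⊔ N := le_sup_right
  have hdvd : (Λ ⊔ N).index ∣ 2 := hidx ▸ Subgroup.index_dvd_of_le hle
  rcases (Nat.dvd_prime Nat.prime_two).1 hdvd with h1 | h2
  · exact Subgroup.index_eq_one.1 h1
  · exfalso
    apply hΛ
    have hrel := Subgroup.relIndex_mul_index hle
    rw [h2, hidx] at hrel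
    have h1 : N.relIndex (Λ ⊔ N) = 1 := by omega
    exact le_sup_left.trans (Subgroup.relIndex_eq_one.1 h1)

/-- **Quadratic induction: `(Ind_{Γ_F}^{Γ_K} ψ)|_{Γ_L}` is absolutely irreducible**, the shape of
the residual hypothesis "`(Ind_E^K r̄)|_{K(ζ_p)}` absolutely irreducible" of the potential
automorphy theorems.  Let `F/K` be a quadratic (Galois) extension, `L/K` with `res(Γ_L)` normal in
`Γ_K` and `L ⊄ F` (`res(Γ_L) ⊄ res(Γ_F)`), `M/F` presenting `Γ_{FL}` (hypothesis `hM`), and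
`ψ : Γ_F →ₜ* GL_m(A)` with `ψ|_{Γ_M}` absolutely irreducible and, for every `g ∉ res(Γ_F)` (any
lift of the non-trivial element of `Gal(F/K)`), `ψ|_{Γ_M}` and `ψ^g|_{Γ_M}` with different
characteristic polynomials somewhere.  Then `((ψ.induce K hd).restrictField L)` is absolutely
irreducible. [cite: SerreLinearRepresentations1977, §7.4 Prop. 23 and Cor.] -/
theorem isAbsolutelyIrreducible_restrictField_induce_of_finrank_eq_two
    (hd : Module.finrank K F = 2) (ψ : FramedGaloisRep F A m) (L : Type*) [Field L] [Algebra K L]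
    (hnormal : ((absGaloisRestrict K L).range : Subgroup (absoluteGaloisGroup K)).Normal)
    (hLF : ¬ (absGaloisRestrict K L).range ≤ (absGaloisRestrict K F).range)
    (M : Type*) [Field M] [Algebra F M]
    (hM : ∀ σ : absoluteGaloisGroup F,
      σ ∈ (absGaloisRestrict F M).range ↔ absGaloisRestrict K F σ ∈ (absGaloisRestrict K L).range)
    (hirr : FramedRep.IsAbsolutelyIrreducible (ψ.restrictField M))
    (hreg : ∀ g : absoluteGaloisGroup K, g ∉ (absGaloisRestrict K F).range →
      ∃ σ : absoluteGaloisGroup M, FramedRep.charpoly (ψ.restrictField M) σ ≠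
        FramedRep.charpoly ((ψ.outerConj g).restrictField M) σ) :
    FramedRep.IsAbsolutelyIrreducible ((ψ.induce K hd).restrictField L) :=
  isAbsolutelyIrreducible_restrictField_induce K hd ψ L hnormal
    (sup_range_absGaloisRestrict_eq_top_of_finrank_eq_two K hd _ hLF) M hM hirr hreg

end FramedGaloisRep

end Absolute

end Literature.NumberTheory.GaloisRepresentations

end
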